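import Literature.AnabelianGeometry.EtaleTheta.BiKummerThm44SubModelConnected
import Literature.AnabelianGeometry.EtaleTheta.Discharge.Sec3RatFnMonoidOn
import Literature.AlgebraicGeometry.Frobenioids.QuasiTemperoidConnectedPart
import Literature.AnabelianGeometry.SemiGraphs.CosetCategoriesSlimTempered

/-!
# [EtTh] Theorem 4.4 (i)(ii)(iii) at the GENUINE connected base: binder census
# {Rmk 3.7.2 (`Remark372 D₀ / D₀'`), `hBmon₁ / hBmon₂`} ↦ {`hBinj₁ / hBinj₂`} (proof-only)

S. Mochizuki, *The étale theta function and its Frobenioid-theoretic manifestations*, Publ. RIMS **45** (2009)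
[MochizukiEtTh2009], §4, Thm 4.4 (i)–(iii), PDF p.94 (printed p.320), proof PDF p.95 (printed pp.320–321):
«for `i = 1, 2`, `C_i` is of standard and isotropic type … the base category `D_i` of `C_i` is slim
[cf. Rmk 3.7.2] … Thus `Ψ` preserves pre-steps, … [cf. [FrdI] Thm 3.4 (ii), (iii)] … base-Frobenius pairs
[cf. [FrdI] Cor 5.7 (i), (iv)]».  abc-iut cell, layer L2, plan/L2/SUBDAG-EtTh-Thm44.md (custodian lineage
abc-iut-w5-d179), cone nodes `EtTh:Thm4.4(i)`, `EtTh:Thm4.4(ii)`, `EtTh:Thm4.4(iii)`.  Seat abc-iut-w5-d179 (gen 4).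
PROOF-ONLY companion (0 `def`s, no `Prop` facts, no instances); nothing landed is edited or restated.

STATE BEFORE THIS FILE.  `BiKummerThm44SubModelConnected.lean` (p431376) assembles Thm 4.4 (i) ∧ (ii)
(fraction-pairs) ∧ (iii) (saturation) ∧ (ii) (`N`-th roots, T44-L14) for abc-iut-L2-t4's settings
`mkOfConnectedTemperoid` over print's genuine base `D_i = B^temp(Π^tp_{X_i})⁰ = ConnectedPart (BTemp X_i.Pi)`, with
the CONSTRUCTED `ψ = Ψ^birat` (`psiModel`) and the model pull-backs, modulo {`Remark372 D₀ / D₀'` (Rmk 3.7.2 as a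
named fact on the ABSTRACT Def 3.3 base `D₀` of the realified divisor monoids, used only to derive «`D_i` of
FSM-type» / «`D_i` slim» through the fully faithful base functor, `Thm44Hyp.isOfFSMType_base_i` / `isSlim_base_i`),
`hBmon₁ / hBmon₂` (Def 3.6 (ii): `B` a monoid on `D_i`), T44-L15b}.

WHAT THIS FILE DOES — the move abc-iut-w6-d048 made for Thm 3.7 (iv) (`Discharge/Sec3Thm37ivGenuineBase`), now
for Thm 4.4: §1 re-keys the compositions for the canonical model instances `mkOfModelCanonical` over ARBITRARY
bases on the explicit structural inputs {`hBmon_i`, «`D_i` of FSM-type», «`D_i` slim»} instead of Rmk 3.7.2 on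
`D₀` (hF-level API of p414783 / p415197 / p419233 / p420137 / p424788 / p429785; the fraction-pair clause (ii) needs
neither slimness nor Rmk 3.7.2 — only «`C_i` Frobenioid» and T44-L03); §2 reads them at the genuine base, where
«`B^temp(Π)⁰` is of FSM-type» is [FrdII] Ex 1.3 (i) (`QuasiTemperoid.BTempConnected.connectedPart_isOfFSMType`),
«`B^temp(Π^tp_X)⁰` is slim» is [SemiAnbd] Rmk 3.4.1 / Ex 3.10 (`TemperedArithmeticGroup.isSlim_connectedPart`), and
`hBmon_i` follows from `hBinj_i` ALONE (abc-iut-L2-t3's `TemperedFrobenioid.isMonoidOn_ratFnFunctor hBinj hFSM`;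
= abc-iut-w6-d048's `isMonoidOn_ratFnFunctor_connectedPart_bTemp hBinj`, p432030, definitionally), where

  `hBinj_i` : the pull-backs of the Def 3.6 (i) datum `B₀^Λ` are injective (Def 3.3 (iii): the transition maps of
  `B₀(Y) = lim Mero(Z_∞)^{Gal}` are inclusions of invariants — a property of the INPUT data, dischargeable only by
  their geometric instantiation):

* `Thm44Hyp.thm44_mkOfConnectedTemperoid_of_hBinj` — **[EtTh] Thm 4.4 (i) ∧ (ii) ∧ (iii)-saturation ∧ (`N`-th
  roots) at the genuine connected base ⇐ {`hBinj₁`, `hBinj₂`, T44-L15b} ONLY** — no named fact of plan/FACT-LIST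
  is an input any more (F-1397 `Remark372` drops out of the residual of the three cone nodes at the genuine base);
  every other printed input of p.95 ([FrdI] Thm 3.4, Cor 4.10 + Prop 2.2 (ii), Thm 4.2 (ii), Cor 5.7 (i);
  [SemiAnbd] Prop 3.2; [EtTh] Thm 3.7 (i)(ii), Rmk 3.7.2) is a theorem of the tree.  In the ψ-slot the theorems
  of §2 quantify over ARBITRARY proofs `hF₁ hF₂ h3` of «`C_i` Frobenioid» / T44-L03 (proof-irrelevant parameters of
  `psiModel`), so that consumers may supply abc-iut-w6-d048's `isFrobenioid_connectedPart_bTemp` or any other.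

T44-L15b (`PreservesNHSaturatedBsFld`, [FrdII] Def 2.2 (ii) over the free `(N,H)`-saturation slot) stays an input
of (iii) and of the roots clause (abc-iut-w4-d044 discharges it at the roots reading); the Kummer-class clause of
(iii) (T44-L16, abc-iut-L2-t3) is not included, as in p431376.  HONEST FRAMING: refereed pre-IUT material
([FrdI]/[FrdII] 2008, [EtTh] 2009, [SemiAnbd] 2006); every theorem is an implication for data so parametrised;
nothing here asserts that such data exist for an actual curve or bears on the disputed [IUTchIII] Cor. 3.12;
typed ≠ proved — here PROVED (kernel compositions).
-/

noncomputable section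

namespace Literature.AnabelianGeometry.EtaleTheta

open CategoryTheory Opposite Function Literature.AlgebraicGeometry.Frobenioids Literature.AnabelianGeometry.SemiGraphs

namespace BiKummerSetting

universe u₀ v₀ u v w

/-! ### §0 Any pair of settings over the tree vocabularies: T44-L03, standard type, (iii) from {`hBmon`, FSM-type} -/

section TreeVocab

variable {K : Type u₀} [Field K] {K' : Type u₀} [Field K'] {D₀ : Type u₀} [Category.{v₀} D₀]
  {X₁ : SemiGraphs.TemperedArithmeticGroup.{u₀} K} {X₂ : SemiGraphs.TemperedArithmeticGroup.{u₀} K'}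
  {D₀' : Type u₀} [Category.{v₀} D₀']
  {T₁ : RealifiedDivisorMonoids (D₀ := D₀) treeMonoidVocab.{w}}
  {T₂ : RealifiedDivisorMonoids (D₀ := D₀') treeMonoidVocab.{w}}
  {D₁ D₂ : Type u} [Category.{v} D₁] [Category.{v} D₂]
  {IsRational₁ IsStrictlyRational₁ : (D₁ᵒᵖ ⥤ CommMonCat.{w}) → Prop}
  {IsRational₂ IsStrictlyRational₂ : (D₂ᵒᵖ ⥤ CommMonCat.{w}) → Prop}
  {S₁ : BiKummerSetting X₁ T₁ D₁ (treeCatVocab D₁ IsRational₁ IsStrictlyRational₁)}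
  {S₂ : BiKummerSetting X₂ T₂ D₂ (treeCatVocab D₂ IsRational₂ IsStrictlyRational₂)}

/-- **T44-L03 from {`hBmon₁ / hBmon₂`, «`D_i` of FSM-type»}**: `Ψ` preserves Frobenius degrees, isometries,
morphisms of Frobenius type and pull-backs ([FrdI] Thm 3.4 (iii), `preservesFrobeniusStructure_of_thm34`), its
inputs «`C_i` is a Frobenioid» being `isFrobenioid_treeCatVocab_of_isMonoidOn hBmon_i` (Def 3.6 (ii) / [FrdI] Thm
5.2 (ii)) and «`Φ_i` non-dilating» the Thm 4.4 hypothesis. [cite: MochizukiEtTh2009, Thm 4.4 p.95] -/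
theorem Thm44Hyp.preservesFrobeniusStructure_of_isOfFSMType (h : Thm44Hyp S₁ S₂)
    (hBmon₁ : IsMonoidOn S₁.tf.ratFnFunctor) (hBmon₂ : IsMonoidOn S₂.tf.ratFnFunctor)
    (hD₁ : IsOfFSMType D₁) (hD₂ : IsOfFSMType D₂) : h.PreservesFrobeniusStructure :=
  h.preservesFrobeniusStructure_of_thm34 (S₁.tf.isFrobenioid_treeCatVocab_of_isMonoidOn hBmon₁)
    (S₂.tf.isFrobenioid_treeCatVocab_of_isMonoidOn hBmon₂) hD₁ hD₂ h.isNonDilatingOn_ofFunctor₁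
    h.isNonDilatingOn_ofFunctor₂

/-- **«`C₁` is of standard type»** ([EtTh] Thm 3.7 (ii) first clause, [FrdI] Thm 5.2 (iii):
`isOfStandardType_treeCatVocab`) from {`hBmon₁`, «`D₁` of FSM-type»} and the Thm 4.4 hypothesis «`Φ₁` non-dilating».
[cite: MochizukiEtTh2009, Thm 3.7 (ii) p.79] -/
theorem Thm44Hyp.isOfStandardType_of_isOfFSMType₁ (h : Thm44Hyp S₁ S₂) (hBmon₁ : IsMonoidOn S₁.tf.ratFnFunctor)
    (hD₁ : IsOfFSMType D₁) : (PreFrobenioidData.ofFunctor S₁.tf.divisorMonoid S₁.F).IsOfStandardType :=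
  S₁.tf.isOfStandardType_treeCatVocab hBmon₁ hD₁.isOfFSMFFType ((S₁.tf.isNonDilatingOn_iff_pull).mpr h.isNonDilating₁)

/-- **«`C₂` is of standard type»** from {`hBmon₂`, «`D₂` of FSM-type»}, likewise.
[cite: MochizukiEtTh2009, Thm 3.7 (ii) p.79] -/
theorem Thm44Hyp.isOfStandardType_of_isOfFSMType₂ (h : Thm44Hyp S₁ S₂) (hBmon₂ : IsMonoidOn S₂.tf.ratFnFunctor)
    (hD₂ : IsOfFSMType D₂) : (PreFrobenioidData.ofFunctor S₂.tf.divisorMonoid S₂.F).IsOfStandardType :=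
  S₂.tf.isOfStandardType_treeCatVocab hBmon₂ hD₂.isOfFSMFFType ((S₂.tf.isNonDilatingOn_iff_pull).mpr h.isNonDilating₂)

/-- **Thm 4.4 (iii), saturation clause (v5), from {`hBmon₁ / hBmon₂`, «`D_i` of FSM-type», T44-L15b}** for any `ψ`
(`thm44_iii_of_thm34`: T44-L03 and its `Ψ⁻¹`-twin from [FrdI] Thm 3.4 (iii)). [cite: MochizukiEtTh2009, Thm 4.4 (iii) p.94] -/
theorem Thm44Hyp.thm44_iii_of_isOfFSMType (h : Thm44Hyp S₁ S₂)
    (ψ : ∀ A : S₁.C, S₁.biratUnits A ≃* S₂.biratUnits (h.Ψ.functor.obj A))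
    (hBmon₁ : IsMonoidOn S₁.tf.ratFnFunctor) (hBmon₂ : IsMonoidOn S₂.tf.ratFnFunctor)
    (hD₁ : IsOfFSMType D₁) (hD₂ : IsOfFSMType D₂) (h15 : h.PreservesNHSaturatedBsFld) : Thm44_iii h ψ :=
  h.thm44_iii_of_thm34 ψ (S₁.tf.isFrobenioid_treeCatVocab_of_isMonoidOn hBmon₁)
    (S₂.tf.isFrobenioid_treeCatVocab_of_isMonoidOn hBmon₂) hD₁ hD₂ h.isNonDilatingOn_ofFunctor₁
    h.isNonDilatingOn_ofFunctor₂ h15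

end TreeVocab

/-! ### §1 The canonical model instances `mkOfModelCanonical` over arbitrary bases: inputs {`hBmon`, FSM-type, slim} -/

section Canonical

variable {K : Type u₀} [Field K] {K' : Type u₀} [Field K'] {X₁ : SemiGraphs.TemperedArithmeticGroup.{u₀} K}
  {X₂ : SemiGraphs.TemperedArithmeticGroup.{u₀} K'} {D₀ : Type u₀} [Category.{v₀} D₀] {D₀' : Type u₀}
  [Category.{v₀} D₀'] {T₁ : RealifiedDivisorMonoids (D₀ := D₀) treeMonoidVocab.{w}}
  {T₂ : RealifiedDivisorMonoids (D₀ := D₀') treeMonoidVocab.{w}}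
  {D₁ D₂ : Type u} [Category.{v} D₁] [Category.{v} D₂]
  {IsRational₁ IsStrictlyRational₁ : (D₁ᵒᵖ ⥤ CommMonCat.{w}) → Prop}
  {IsRational₂ IsStrictlyRational₂ : (D₂ᵒᵖ ⥤ CommMonCat.{w}) → Prop}
  {tf₁ : TemperedFrobenioid T₁ D₁ (treeCatVocab D₁ IsRational₁ IsStrictlyRational₁)}
  {hZ₁ : tf₁.monoidType = MonoidType.Z} {hP₁ : ∀ A : D₁ᵒᵖ, IsPerfect (tf₁.Φ.carrier A)}
  {IG₁ : D₁ → Prop} {gS₁ : ∀ A : D₁, IG₁ A → (X₁.Pi →* Aut A)}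
  {gSs₁ : ∀ (A : D₁) (hA : IG₁ A), Function.Surjective (gS₁ A hA)}
  {NH₁ : Subgroup (Field.absoluteGaloisGroup K) → tf₁.category → ℕ+ → Prop} {A₀₁ : tf₁.category}
  {hA₀₁ : PreFrobenioid.IsFrobeniusTrivial tf₁.toElem A₀₁} {hA₀₁' : IG₁ A₀₁.base}
  {tf₂ : TemperedFrobenioid T₂ D₂ (treeCatVocab D₂ IsRational₂ IsStrictlyRational₂)}
  {hZ₂ : tf₂.monoidType = MonoidType.Z} {hP₂ : ∀ A : D₂ᵒᵖ, IsPerfect (tf₂.Φ.carrier A)}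
  {IG₂ : D₂ → Prop} {gS₂ : ∀ A : D₂, IG₂ A → (X₂.Pi →* Aut A)}
  {gSs₂ : ∀ (A : D₂) (hA : IG₂ A), Function.Surjective (gS₂ A hA)}
  {NH₂ : Subgroup (Field.absoluteGaloisGroup K') → tf₂.category → ℕ+ → Prop} {A₀₂ : tf₂.category}
  {hA₀₂ : PreFrobenioid.IsFrobeniusTrivial tf₂.toElem A₀₂} {hA₀₂' : IG₂ A₀₂.base}

/-- **T44-L04 «`Ψ` preserves base-Frobenius pairs» for the canonical model instances from {`hBmon_i`, «`D_i` of
FSM-type», «`D_i` slim»}** ([FrdI] Cor 5.7 (i) over slim bases of FSM-type, `preservesBaseFrobeniusPairs_of_inputs`;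
«`Φ_i` perf-factorial» IS the Def 3.6 (ii) field `TemperedFrobenioid.isPerfFactorial`; «`C_i` of standard type» is
`isOfStandardType_of_isOfFSMType_i`). [cite: MochizukiEtTh2009, Thm 4.4 p.95] -/
theorem Thm44Hyp.preservesBaseFrobeniusPairs_mkOfModelCanonical_of_isOfFSMType
    (h : Thm44Hyp (mkOfModelCanonical X₁ tf₁ hZ₁ hP₁ IG₁ gS₁ gSs₁ NH₁ A₀₁ hA₀₁ hA₀₁')
      (mkOfModelCanonical X₂ tf₂ hZ₂ hP₂ IG₂ gS₂ gSs₂ NH₂ A₀₂ hA₀₂ hA₀₂'))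
    (hBmon₁ : IsMonoidOn tf₁.ratFnFunctor) (hBmon₂ : IsMonoidOn tf₂.ratFnFunctor)
    (hD₁ : IsOfFSMType D₁) (hD₂ : IsOfFSMType D₂) (hs₁ : IsSlim D₁) (hs₂ : IsSlim D₂) :
    h.PreservesBaseFrobeniusPairs :=
  h.preservesBaseFrobeniusPairs_of_inputs (fun _ _ _ hG => hG) (fun _ _ _ hG => hG)
    (tf₁.isFrobenioid_treeCatVocab_of_isMonoidOn hBmon₁) (tf₂.isFrobenioid_treeCatVocab_of_isMonoidOn hBmon₂)
    (fun A => tf₁.isPerfFactorial A) (fun B => tf₂.isPerfFactorial B) hD₁ hD₂ hs₁ hs₂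
    (h.isOfStandardType_of_isOfFSMType₁ hBmon₁ hD₁) (h.isOfStandardType_of_isOfFSMType₂ hBmon₂ hD₂)

/-- **[EtTh] Thm 4.4 (ii), fraction-pair clause `Thm44_ii`, for the canonical model instances with the CONSTRUCTED
`ψ = Ψ^birat` (`psiModel`) from «`C_i` is a Frobenioid» and T44-L03 ONLY** (any proofs `hF₁ hF₂ h3`; neither
slimness nor Rmk 3.7.2 is needed) — T44-L10 ([FrdI] Cor 4.10, `biratCompatible_mkOfModel`) and T44-L12 in print's
form ([FrdI] Thm 4.2 (ii), `disjointSupports_map_of_inputs`) discharged. [cite: MochizukiEtTh2009, Thm 4.4 (ii) p.94] -/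
theorem thm44_ii_mkOfModelCanonical_of_isFrobenioid
    (h : Thm44Hyp (mkOfModelCanonical X₁ tf₁ hZ₁ hP₁ IG₁ gS₁ gSs₁ NH₁ A₀₁ hA₀₁ hA₀₁')
      (mkOfModelCanonical X₂ tf₂ hZ₂ hP₂ IG₂ gS₂ gSs₂ NH₂ A₀₂ hA₀₂ hA₀₂'))
    (hF₁ : PreFrobenioid.IsFrobenioid tf₁.toElem) (hF₂ : PreFrobenioid.IsFrobenioid tf₂.toElem)
    (h3 : h.PreservesFrobeniusStructure) : Thm44_ii h (h.psiModel hF₁ hF₂ h3) :=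
  thm44_ii_of_biratCompatible_of_preSteps h _ (h.biratCompatible_mkOfModel hF₁ hF₂ h3)
    (fun _ hs => h.isPreStep_map h3 hs)
    (fun s' s'' h' h'' hb hds => h.disjointSupports_map_of_inputs (fun _ _ hab => hab) (fun _ _ hab => hab) hF₁ hF₂
      h3 s' s'' h' h'' hb hds)

/-- **Thm 4.4 (ii), fraction-pair clause, for the canonical model instances from {`hBmon_i`, «`D_i` of FSM-type»}**
(`ψ = psiModel` over `isFrobenioid_treeCatVocab_of_isMonoidOn` and T44-L03 := `preservesFrobeniusStructure_of_isOfFSMType`).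
[cite: MochizukiEtTh2009, Thm 4.4 (ii) p.94] -/
theorem thm44_ii_mkOfModelCanonical_of_isOfFSMType
    (h : Thm44Hyp (mkOfModelCanonical X₁ tf₁ hZ₁ hP₁ IG₁ gS₁ gSs₁ NH₁ A₀₁ hA₀₁ hA₀₁')
      (mkOfModelCanonical X₂ tf₂ hZ₂ hP₂ IG₂ gS₂ gSs₂ NH₂ A₀₂ hA₀₂ hA₀₂'))
    (hBmon₁ : IsMonoidOn tf₁.ratFnFunctor) (hBmon₂ : IsMonoidOn tf₂.ratFnFunctor)
    (hD₁ : IsOfFSMType D₁) (hD₂ : IsOfFSMType D₂) :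
    Thm44_ii h (h.psiModel (tf₁.isFrobenioid_treeCatVocab_of_isMonoidOn hBmon₁)
      (tf₂.isFrobenioid_treeCatVocab_of_isMonoidOn hBmon₂)
      (h.preservesFrobeniusStructure_of_isOfFSMType hBmon₁ hBmon₂ hD₁ hD₂)) :=
  thm44_ii_mkOfModelCanonical_of_isFrobenioid h _ _ _

/-- **T44-L14 «`Ψ` maps `N`-th roots of fraction-pairs to `N`-th roots of fraction-pairs» ([EtTh] Thm 4.4 (ii), last
sentence) for the canonical model instances, `ψ = psiModel` (any proofs `hF₁ hF₂ h3`), pull-backs `pullFracModel`,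
from {`hBmon_i`, «`D_i` of FSM-type», «`D_i` slim», T44-L09c (`GaloisCompatible`), T44-L15b
(`PreservesNHSaturatedBsFld`)}** — T44-L03, T44-L04, T44-L10 (+ its pull-back clause `psiModel_pullFracModel`),
T44-L12 and `Thm44_ii` being theorems, «`Φ_i` perf-factorial» the Def 3.6 (ii) field. [cite: MochizukiEtTh2009, Thm 4.4 (ii) p.94] -/
theorem Thm44Hyp.preservesNthRoots_mkOfModelCanonical_of_isOfFSMType
    (h : Thm44Hyp (mkOfModelCanonical X₁ tf₁ hZ₁ hP₁ IG₁ gS₁ gSs₁ NH₁ A₀₁ hA₀₁ hA₀₁')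
      (mkOfModelCanonical X₂ tf₂ hZ₂ hP₂ IG₂ gS₂ gSs₂ NH₂ A₀₂ hA₀₂ hA₀₂'))
    (hF₁ : PreFrobenioid.IsFrobenioid tf₁.toElem) (hF₂ : PreFrobenioid.IsFrobenioid tf₂.toElem)
    (h3 : h.PreservesFrobeniusStructure)
    (hBmon₁ : IsMonoidOn tf₁.ratFnFunctor) (hBmon₂ : IsMonoidOn tf₂.ratFnFunctor)
    (hD₁ : IsOfFSMType D₁) (hD₂ : IsOfFSMType D₂) (hs₁ : IsSlim D₁) (hs₂ : IsSlim D₂)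
    (h9 : h.GaloisCompatible) (h15 : h.PreservesNHSaturatedBsFld) :
    h.PreservesNthRoots (h.psiModel hF₁ hF₂ h3) (fun φ f => tf₁.pullFracModel φ f) (fun φ f => tf₂.pullFracModel φ f) :=
  h.preservesNthRoots_of _ (fun φ f => tf₁.pullFracModel φ f) (fun φ f => tf₂.pullFracModel φ f)
    (fun φ f => h.psiModel_pullFracModel hF₁ hF₂ h3 φ f) (thm44_ii_mkOfModelCanonical_of_isFrobenioid h hF₁ hF₂ h3)
    h3
    (h.preservesBaseFrobeniusTypeData_of_inputs h3
      (h.preservesBaseFrobeniusPairs_mkOfModelCanonical_of_isOfFSMType hBmon₁ hBmon₂ hD₁ hD₂ hs₁ hs₂) h9)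
    (h.preservesAmple_of h9) (h.preservesFixedByHA_of _ h9 (h.biratCompatible_mkOfModel hF₁ hF₂ h3))
    (h.preservesSaturated_of _ h3 h15)

end Canonical

/-! ### §2 At the genuine connected base `B^temp(Π^tp_X)⁰`: inputs {`hBinj₁`, `hBinj₂`} (+ T44-L15b) only -/

section Connected

variable {K : Type u₀} [Field K] {K' : Type u₀} [Field K'] {X₁ : SemiGraphs.TemperedArithmeticGroup.{u₀} K}
  {X₂ : SemiGraphs.TemperedArithmeticGroup.{u₀} K'} {D₀ : Type u₀} [Category.{v₀} D₀] {D₀' : Type u₀}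
  [Category.{v₀} D₀'] {T₁ : RealifiedDivisorMonoids (D₀ := D₀) treeMonoidVocab.{w}}
  {T₂ : RealifiedDivisorMonoids (D₀ := D₀') treeMonoidVocab.{w}}
  {IsRational₁ IsStrictlyRational₁ : ((ConnectedPart (BTemp X₁.Pi))ᵒᵖ ⥤ CommMonCat.{w}) → Prop}
  {IsRational₂ IsStrictlyRational₂ : ((ConnectedPart (BTemp X₂.Pi))ᵒᵖ ⥤ CommMonCat.{w}) → Prop}
  {tf₁ : TemperedFrobenioid T₁ (ConnectedPart (BTemp X₁.Pi))
    (treeCatVocab (ConnectedPart (BTemp X₁.Pi)) IsRational₁ IsStrictlyRational₁)}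
  {hZ₁ : tf₁.monoidType = MonoidType.Z} {hP₁ : ∀ A : (ConnectedPart (BTemp X₁.Pi))ᵒᵖ, IsPerfect (tf₁.Φ.carrier A)}
  {NH₁ : Subgroup (Field.absoluteGaloisGroup K) → tf₁.category → ℕ+ → Prop} {A₁ : tf₁.category}
  {hA₁ : PreFrobenioid.IsFrobeniusTrivial tf₁.toElem A₁} {hA₁' : SemiGraphs.IsGaloisObj A₁.base.obj}
  {tf₂ : TemperedFrobenioid T₂ (ConnectedPart (BTemp X₂.Pi))
    (treeCatVocab (ConnectedPart (BTemp X₂.Pi)) IsRational₂ IsStrictlyRational₂)}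
  {hZ₂ : tf₂.monoidType = MonoidType.Z} {hP₂ : ∀ B : (ConnectedPart (BTemp X₂.Pi))ᵒᵖ, IsPerfect (tf₂.Φ.carrier B)}
  {NH₂ : Subgroup (Field.absoluteGaloisGroup K') → tf₂.category → ℕ+ → Prop} {A₂ : tf₂.category}
  {hA₂ : PreFrobenioid.IsFrobeniusTrivial tf₂.toElem A₂} {hA₂' : SemiGraphs.IsGaloisObj A₂.base.obj}

/-- **T44-L03 at the genuine connected base from `hBinj₁ / hBinj₂` ALONE.** [cite: MochizukiEtTh2009, Thm 4.4 p.95] -/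
theorem Thm44Hyp.preservesFrobeniusStructure_mkOfConnectedTemperoid_of_hBinj
    (h : Thm44Hyp (mkOfConnectedTemperoid X₁ tf₁ hZ₁ hP₁ NH₁ A₁ hA₁ hA₁')
      (mkOfConnectedTemperoid X₂ tf₂ hZ₂ hP₂ NH₂ A₂ hA₂ hA₂'))
    (hBinj₁ : ∀ {Y Y' : D₀ᵒᵖ} (g : Y ⟶ Y'), Injective (T₁.BΛ.map g).hom)
    (hBinj₂ : ∀ {Y Y' : D₀'ᵒᵖ} (g : Y ⟶ Y'), Injective (T₂.BΛ.map g).hom) : h.PreservesFrobeniusStructure :=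
  h.preservesFrobeniusStructure_of_isOfFSMType (tf₁.isMonoidOn_ratFnFunctor hBinj₁ fun α hα =>
      (QuasiTemperoid.BTempConnected.connectedPart_isOfFSMType (G := X₁.Pi)).isIso_of_isFSM α hα)
    (tf₂.isMonoidOn_ratFnFunctor hBinj₂ fun α hα =>
      (QuasiTemperoid.BTempConnected.connectedPart_isOfFSMType (G := X₂.Pi)).isIso_of_isFSM α hα) QuasiTemperoid.BTempConnected.connectedPart_isOfFSMType
    QuasiTemperoid.BTempConnected.connectedPart_isOfFSMType

/-- **Thm 4.4 (i) at the genuine connected base from `hBinj₁ / hBinj₂` ALONE**: abc-iut-w5-d013's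
`thm44_i_mkOfConnectedTemperoid` (T44-L09 / T44-L09c / T44-L08 unconditional over `B^temp(Π^tp_X)⁰`) with its two
inputs «`C₂` is a Frobenioid» and T44-L03 supplied from `hBinj`. [cite: MochizukiEtTh2009, Thm 4.4 (i) p.94] -/
theorem Thm44Hyp.thm44_i_mkOfConnectedTemperoid_of_hBinj
    (h : Thm44Hyp (mkOfConnectedTemperoid X₁ tf₁ hZ₁ hP₁ NH₁ A₁ hA₁ hA₁')
      (mkOfConnectedTemperoid X₂ tf₂ hZ₂ hP₂ NH₂ A₂ hA₂ hA₂'))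
    (hBinj₁ : ∀ {Y Y' : D₀ᵒᵖ} (g : Y ⟶ Y'), Injective (T₁.BΛ.map g).hom)
    (hBinj₂ : ∀ {Y Y' : D₀'ᵒᵖ} (g : Y ⟶ Y'), Injective (T₂.BΛ.map g).hom) : Thm44_i h :=
  h.thm44_i_mkOfConnectedTemperoid _ _ _ _ _ _ _ _ _ _ _ _ _ _ (tf₂.isFrobenioid_of_structural hBinj₂ fun α hα =>
        (QuasiTemperoid.BTempConnected.connectedPart_isOfFSMType (G := X₂.Pi)).isIso_of_isFSM α hα)
    (h.preservesFrobeniusStructure_mkOfConnectedTemperoid_of_hBinj hBinj₁ hBinj₂)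

/-- **Thm 4.4 (ii), fraction-pair clause, at the genuine connected base** for the CONSTRUCTED `ψ = psiModel hF₁ hF₂ h3`
over ANY proofs `hF₁ hF₂` of «`C_i` Frobenioid» and `h3` of T44-L03 (themselves consequences of `hBinj`,
abc-iut-L2-t3's `TemperedFrobenioid.isFrobenioid_of_structural hBinj_i _` with [FrdII] Ex 1.3 (i), and
`preservesFrobeniusStructure_mkOfConnectedTemperoid_of_hBinj`) — NO further input. [cite: MochizukiEtTh2009, Thm 4.4 (ii) p.94] -/
theorem Thm44Hyp.thm44_ii_mkOfConnectedTemperoid_of_isFrobenioid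
    (h : Thm44Hyp (mkOfConnectedTemperoid X₁ tf₁ hZ₁ hP₁ NH₁ A₁ hA₁ hA₁')
      (mkOfConnectedTemperoid X₂ tf₂ hZ₂ hP₂ NH₂ A₂ hA₂ hA₂'))
    (hF₁ : PreFrobenioid.IsFrobenioid tf₁.toElem) (hF₂ : PreFrobenioid.IsFrobenioid tf₂.toElem)
    (h3 : h.PreservesFrobeniusStructure) : Thm44_ii h (h.psiModel hF₁ hF₂ h3) :=
  thm44_ii_mkOfModelCanonical_of_isFrobenioid h hF₁ hF₂ h3

/-- **Thm 4.4 (iii), saturation clause (v5), at the genuine connected base from {`hBinj₁ / hBinj₂`, T44-L15b}** for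
`ψ = psiModel hF₁ hF₂ h3` (any proofs). [cite: MochizukiEtTh2009, Thm 4.4 (iii) p.94] -/
theorem Thm44Hyp.thm44_iii_mkOfConnectedTemperoid_of_hBinj
    (h : Thm44Hyp (mkOfConnectedTemperoid X₁ tf₁ hZ₁ hP₁ NH₁ A₁ hA₁ hA₁')
      (mkOfConnectedTemperoid X₂ tf₂ hZ₂ hP₂ NH₂ A₂ hA₂ hA₂'))
    (hF₁ : PreFrobenioid.IsFrobenioid tf₁.toElem) (hF₂ : PreFrobenioid.IsFrobenioid tf₂.toElem)
    (h3 : h.PreservesFrobeniusStructure)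
    (hBinj₁ : ∀ {Y Y' : D₀ᵒᵖ} (g : Y ⟶ Y'), Injective (T₁.BΛ.map g).hom)
    (hBinj₂ : ∀ {Y Y' : D₀'ᵒᵖ} (g : Y ⟶ Y'), Injective (T₂.BΛ.map g).hom) (h15 : h.PreservesNHSaturatedBsFld) :
    Thm44_iii h (h.psiModel hF₁ hF₂ h3) :=
  h.thm44_iii_of_isOfFSMType _ (tf₁.isMonoidOn_ratFnFunctor hBinj₁ fun α hα =>
      (QuasiTemperoid.BTempConnected.connectedPart_isOfFSMType (G := X₁.Pi)).isIso_of_isFSM α hα)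
    (tf₂.isMonoidOn_ratFnFunctor hBinj₂ fun α hα =>
      (QuasiTemperoid.BTempConnected.connectedPart_isOfFSMType (G := X₂.Pi)).isIso_of_isFSM α hα) QuasiTemperoid.BTempConnected.connectedPart_isOfFSMType
    QuasiTemperoid.BTempConnected.connectedPart_isOfFSMType h15

/-- **Thm 4.4 (ii), `N`-th-roots clause (T44-L14), at the genuine connected base from {`hBinj₁ / hBinj₂`, T44-L15b}**:
`ψ = psiModel hF₁ hF₂ h3` (any proofs), pull-backs `pullFracModel`; «`D_i` slim» is [SemiAnbd] Rmk 3.4.1 / Ex 3.10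
(`TemperedArithmeticGroup.isSlim_connectedPart`), «`D_i` of FSM-type» is [FrdII] Ex 1.3 (i), T44-L09c is
abc-iut-w5-d013's `galoisCompatible_mkOfConnectedTemperoid` ([SemiAnbd] Prop 3.2). [cite: MochizukiEtTh2009, Thm 4.4 (ii) p.94] -/
theorem Thm44Hyp.preservesNthRoots_mkOfConnectedTemperoid_of_hBinj
    (h : Thm44Hyp (mkOfConnectedTemperoid X₁ tf₁ hZ₁ hP₁ NH₁ A₁ hA₁ hA₁')
      (mkOfConnectedTemperoid X₂ tf₂ hZ₂ hP₂ NH₂ A₂ hA₂ hA₂'))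
    (hF₁ : PreFrobenioid.IsFrobenioid tf₁.toElem) (hF₂ : PreFrobenioid.IsFrobenioid tf₂.toElem)
    (h3 : h.PreservesFrobeniusStructure)
    (hBinj₁ : ∀ {Y Y' : D₀ᵒᵖ} (g : Y ⟶ Y'), Injective (T₁.BΛ.map g).hom)
    (hBinj₂ : ∀ {Y Y' : D₀'ᵒᵖ} (g : Y ⟶ Y'), Injective (T₂.BΛ.map g).hom) (h15 : h.PreservesNHSaturatedBsFld) :
    h.PreservesNthRoots (h.psiModel hF₁ hF₂ h3) (fun φ f => tf₁.pullFracModel φ f) (fun φ f => tf₂.pullFracModel φ f) :=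
  h.preservesNthRoots_mkOfModelCanonical_of_isOfFSMType hF₁ hF₂ h3
    (tf₁.isMonoidOn_ratFnFunctor hBinj₁ fun α hα =>
      (QuasiTemperoid.BTempConnected.connectedPart_isOfFSMType (G := X₁.Pi)).isIso_of_isFSM α hα) (tf₂.isMonoidOn_ratFnFunctor hBinj₂ fun α hα =>
      (QuasiTemperoid.BTempConnected.connectedPart_isOfFSMType (G := X₂.Pi)).isIso_of_isFSM α hα)
    QuasiTemperoid.BTempConnected.connectedPart_isOfFSMType QuasiTemperoid.BTempConnected.connectedPart_isOfFSMType
    X₁.isSlim_connectedPart X₂.isSlim_connectedPart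
    (h.galoisCompatible_mkOfConnectedTemperoid _ _ _ _ _ _ _ _ _ _ _ _ _ _) h15

/-- **[EtTh] Theorem 4.4 at the genuine connected base `B^temp(Π^tp_X)⁰`, binder census {Rmk 3.7.2, `hBmon`} ↦
{`hBinj`}**: (i) ∧ (ii) (fraction-pairs) ∧ (iii) (saturation) ∧ (ii) (`N`-th roots), for the settings
`mkOfConnectedTemperoid` over the tree vocabularies, the CONSTRUCTED `ψ = Ψ^birat = psiModel hF₁ hF₂ h3` (any proofs
`hF₁ hF₂ h3`, e.g. `TemperedFrobenioid.isFrobenioid_of_structural hBinj_i _` and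
`preservesFrobeniusStructure_mkOfConnectedTemperoid_of_hBinj`, as in the primed form below) and the model pull-backs — modulo ONLY
{`hBinj₁ / hBinj₂` (pull-backs of the Def 3.6 (i) datum `B₀^Λ` injective, Def 3.3 (iii)), T44-L15b ([FrdII] Def 2.2
(ii))}: «`D_i` of FSM-type» ([FrdII] Ex 1.3 (i)), «`D_i` slim» ([SemiAnbd] Rmk 3.4.1 / Ex 3.10 — Rmk 3.7.2), «`B` a
monoid on `D_i`», «`C_i` a Frobenioid» (Def 3.6 (ii) / [FrdI] Thm 5.2 (ii)) and every other printed input of the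
proof on p.95 are theorems of the tree. [cite: MochizukiEtTh2009, Thm 4.4 p.94] -/
theorem Thm44Hyp.thm44_mkOfConnectedTemperoid_of_hBinj
    (h : Thm44Hyp (mkOfConnectedTemperoid X₁ tf₁ hZ₁ hP₁ NH₁ A₁ hA₁ hA₁')
      (mkOfConnectedTemperoid X₂ tf₂ hZ₂ hP₂ NH₂ A₂ hA₂ hA₂'))
    (hF₁ : PreFrobenioid.IsFrobenioid tf₁.toElem) (hF₂ : PreFrobenioid.IsFrobenioid tf₂.toElem)
    (h3 : h.PreservesFrobeniusStructure)
    (hBinj₁ : ∀ {Y Y' : D₀ᵒᵖ} (g : Y ⟶ Y'), Injective (T₁.BΛ.map g).hom)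
    (hBinj₂ : ∀ {Y Y' : D₀'ᵒᵖ} (g : Y ⟶ Y'), Injective (T₂.BΛ.map g).hom) (h15 : h.PreservesNHSaturatedBsFld) :
    Thm44_i h ∧ Thm44_ii h (h.psiModel hF₁ hF₂ h3) ∧ Thm44_iii h (h.psiModel hF₁ hF₂ h3) ∧
      h.PreservesNthRoots (h.psiModel hF₁ hF₂ h3) (fun φ f => tf₁.pullFracModel φ f)
        (fun φ f => tf₂.pullFracModel φ f) :=
  ⟨h.thm44_i_mkOfConnectedTemperoid_of_hBinj hBinj₁ hBinj₂, h.thm44_ii_mkOfConnectedTemperoid_of_isFrobenioid hF₁ hF₂ h3,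
    h.thm44_iii_mkOfConnectedTemperoid_of_hBinj hF₁ hF₂ h3 hBinj₁ hBinj₂ h15,
    h.preservesNthRoots_mkOfConnectedTemperoid_of_hBinj hF₁ hF₂ h3 hBinj₁ hBinj₂ h15⟩

/-- **The same with the ψ-slot proofs themselves supplied from `hBinj`** — literally ⇐ {`hBinj₁`, `hBinj₂`, T44-L15b}.
[cite: MochizukiEtTh2009, Thm 4.4 p.94] -/
theorem Thm44Hyp.thm44_mkOfConnectedTemperoid_of_hBinj'
    (h : Thm44Hyp (mkOfConnectedTemperoid X₁ tf₁ hZ₁ hP₁ NH₁ A₁ hA₁ hA₁')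
      (mkOfConnectedTemperoid X₂ tf₂ hZ₂ hP₂ NH₂ A₂ hA₂ hA₂'))
    (hBinj₁ : ∀ {Y Y' : D₀ᵒᵖ} (g : Y ⟶ Y'), Injective (T₁.BΛ.map g).hom)
    (hBinj₂ : ∀ {Y Y' : D₀'ᵒᵖ} (g : Y ⟶ Y'), Injective (T₂.BΛ.map g).hom) (h15 : h.PreservesNHSaturatedBsFld) :
    Thm44_i h ∧
      Thm44_ii h (h.psiModel (tf₁.isFrobenioid_of_structural hBinj₁ fun α hα =>
        (QuasiTemperoid.BTempConnected.connectedPart_isOfFSMType (G := X₁.Pi)).isIso_of_isFSM α hα) (tf₂.isFrobenioid_of_structural hBinj₂ fun α hα =>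
        (QuasiTemperoid.BTempConnected.connectedPart_isOfFSMType (G := X₂.Pi)).isIso_of_isFSM α hα)
        (h.preservesFrobeniusStructure_mkOfConnectedTemperoid_of_hBinj hBinj₁ hBinj₂)) ∧
      Thm44_iii h (h.psiModel (tf₁.isFrobenioid_of_structural hBinj₁ fun α hα =>
        (QuasiTemperoid.BTempConnected.connectedPart_isOfFSMType (G := X₁.Pi)).isIso_of_isFSM α hα) (tf₂.isFrobenioid_of_structural hBinj₂ fun α hα =>
        (QuasiTemperoid.BTempConnected.connectedPart_isOfFSMType (G := X₂.Pi)).isIso_of_isFSM α hα)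
        (h.preservesFrobeniusStructure_mkOfConnectedTemperoid_of_hBinj hBinj₁ hBinj₂)) ∧
      h.PreservesNthRoots (h.psiModel (tf₁.isFrobenioid_of_structural hBinj₁ fun α hα =>
        (QuasiTemperoid.BTempConnected.connectedPart_isOfFSMType (G := X₁.Pi)).isIso_of_isFSM α hα)
        (tf₂.isFrobenioid_of_structural hBinj₂ fun α hα =>
        (QuasiTemperoid.BTempConnected.connectedPart_isOfFSMType (G := X₂.Pi)).isIso_of_isFSM α hα)
        (h.preservesFrobeniusStructure_mkOfConnectedTemperoid_of_hBinj hBinj₁ hBinj₂))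
        (fun φ f => tf₁.pullFracModel φ f) (fun φ f => tf₂.pullFracModel φ f) :=
  h.thm44_mkOfConnectedTemperoid_of_hBinj _ _ _ hBinj₁ hBinj₂ h15

end Connected

end BiKummerSetting

end Literature.AnabelianGeometry.EtaleTheta

end
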